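import Summits.HubbardSuperconductivity.HubbardSuperconductivity.Theorems.BalabanIRBirEveryGroundStateAffine
import Literature.MathematicalPhysics.QuantumLattice.BdGBondHamiltonianTorus

/-!
# Route `BalabanIR`, crux 5 `BirEveryGroundState` (item `stmt-HubbardSuperconductivity-2083`),
# stub `stub_noJointEigenGround` of line `spectral-curve-anchor`: the doublon-free core

The stub asks that, under the window-average `d`-wave hypothesis, no sector ground state of the
repulsive Hubbard torus be an eigenvector of the doublon number `D = Σ_x n_{x↑} n_{x↓}` (a "T/U
state", Bruus–Anglès d'Auriac 1997 §5.2). Proved here, for its doublon-free case `D ψ = 0`: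

* `singletStar_mulVec_eq_zero_of_doublonFree` — on ANY finite graph: if `D ψ = 0` and
  `D (H(t,0) ψ) = 0`, `t ≠ 0` (e.g. `ψ` a doublon-free eigenvector of some `H(t,U)`), then every
  LOCAL EXTENDED-`s` singlet operator `B_x = Σ_{y ∼ x} (c_{x↑}c_{y↓} - c_{x↓}c_{y↑})` kills `ψ`.
  Mechanism (exact operator identities, no Jordan–Wigner bookkeeping): the one-doublon part of
  the hopping image is `n_{x↑}n_{x↓} H(t,0) ψ = t · c†_{x↑}c†_{x↓} B_x ψ`
  (`doublonAt_mul_sum_hop_from`), and `c_{x↓}c_{x↑}c†_{x↑}c†_{x↓} = (1-n_{x↑})(1-n_{x↓})`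
  (`pairAnnihilate_mul_pairCreate`) fixes `B_x ψ`.
* Torus form (`L ≥ 3`, `t ≠ 0`, any `U`, any eigenvalue, any sector):
  `localPair_extendedSWave_mulVec_eq_zero_of_eigen_doublonFree`,
  `extendedSWave_dark_of_eigen_doublonFree` — a doublon-free eigenvector (e.g. a doublon-free
  sector ground state) of `hubbardTorus 2 L t U` is killed by every `localPair extendedSWave L x`
  and by `pairField extendedSWave L`.

**The `d`-wave analogue is FALSE** (only the SUM `B_x ψ` over the four bonds at `x` vanishes, the
`d`-wave difference of the two axes is free): on the torus of even side `L ≥ 4`,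
`φ_k(a,b) = (-1)^b [a - b = k]` are hopping zero modes supported on one diagonal, and
`ψ = (Σ_z φ_0(z) c†_{z↑})(Σ_w φ_1(w) c†_{w↓})|0⟩` is a doublon-free `(2, S^z = 0)` vector with
`H(t,U) ψ = 0` for all `U` and `Δ_{s*} ψ = 0`, but `Δ_d ψ = -(const)·L |0⟩ ≠ 0` (exact check at
`L = 4, 6`; see the companion file `…StubNoJointEigenGroundAverage` for the census and for what
remains open). Sources: H. Bruus, J.-C. Anglès d'Auriac, PRB 55 (1997) 9142, §5.2; C. N. Yang,
PRL 63 (1989) 2144; D. J. Scalapino, Phys. Rep. 250 (1995) 329, §2; H. Tasaki (2020) §9.2–9.3.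
Folklore; no definition is introduced.
-/

noncomputable section

namespace Summit.HubbardSuperconductivity.HubbardSuperconductivity.Theorems

open Matrix Finset Literature.Probability.LatticeModels Literature.MathematicalPhysics.QuantumLattice

/-! ### One-site CAR bookkeeping for the doublon projector `n_{x↑} n_{x↓}` -/

section OneSite

variable {Λ : Type*} [LinearOrder Λ] [Fintype Λ]


omit [LinearOrder Λ] [Fintype Λ] in
/-- The two orbitals of a site are distinct: `(x,↑) ≠ (x,↓)`. [folklore] -/
theorem orb_zero_ne_orb_one' (x : Λ) : (orb x 0 : Orb Λ) ≠ orb x 1 := by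
  simp

/-- `n_{xσ} c†_{xσ} = c†_{xσ}`. Tasaki (2020) §9.2. [folklore] -/
theorem numberOp_mul_creation_self' (x : Λ) (σ : Fin 2) :
    (numberOp x σ * creation (orb x σ)) = creation (orb x σ) :=
  number_mul_creation_self (orb x σ)

/-- `n_{xσ} c_{xσ} = 0`. Tasaki (2020) §9.2. [folklore] -/
theorem numberOp_mul_annihilation_self' (x : Λ) (σ : Fin 2) :
    (numberOp x σ * annihilation (orb x σ)) = 0 := by
  show creation (orb x σ) * annihilation (orb x σ) * annihilation (orb x σ) = 0
  rw [mul_assoc, LiebThm1.annihilation_mul_self, mul_zero]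

/-- `c_{xσ} n_{xσ} = c_{xσ}`. Tasaki (2020) §9.2. [folklore] -/
theorem annihilation_mul_numberOp_self' (x : Λ) (σ : Fin 2) :
    (annihilation (orb x σ) * numberOp x σ) = annihilation (orb x σ) := by
  show annihilation (orb x σ) * (creation (orb x σ) * annihilation (orb x σ)) = _
  rw [← mul_assoc, LiebThm1.annihilation_mul_creation_mul_annihilation]

/-- `n_{xσ}` commutes with `c†_j` for `j ≠ (x,σ)`. Tasaki (2020) §9.2. [folklore] -/
theorem numberOp_mul_creation_of_ne' {x : Λ} {σ : Fin 2} {j : Orb Λ} (h : orb x σ ≠ j) :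
    (numberOp x σ * creation j) = creation j * numberOp x σ :=
  number_mul_creation_of_ne h

/-- `n_{xσ}` commutes with `c_j` for `j ≠ (x,σ)` (adjoint of the previous identity). [folklore] -/
theorem numberOp_mul_annihilation_of_ne' {x : Λ} {σ : Fin 2} {j : Orb Λ} (h : orb x σ ≠ j) :
    (numberOp x σ * annihilation j) = annihilation j * numberOp x σ := by
  have h1 := congrArg conjTranspose (numberOp_mul_creation_of_ne' h)
  have hn : (numberOp x σ)ᴴ = numberOp x σ := (numberAt_isHermitian (orb x σ)).eq
  rw [conjTranspose_mul, conjTranspose_mul, creation_conjTranspose, hn] at h1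
  exact h1.symm

/-- Number operators commute. Tasaki (2020) §9.2. [folklore] -/
theorem numberOp_comm' (x y : Λ) (σ τ : Fin 2) :
    (numberOp x σ * numberOp y τ) = numberOp y τ * numberOp x σ :=
  (numberAt_commute (orb x σ) (orb y τ)).eq

/-- The doublon projector kills both annihilators of its site: `n_{x↑} n_{x↓} c_{xσ} = 0`.
Yang, PRL 63 (1989) 2144. [folklore] -/
theorem doublonAt_mul_annihilation_self (x : Λ) (σ : Fin 2) :
    (numberOp x 0 * numberOp x 1 * annihilation (orb x σ)) = 0 := by
  fin_cases σ
  · rw [numberOp_comm', mul_assoc]; simp [numberOp_mul_annihilation_self']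
  · rw [mul_assoc]; simp [numberOp_mul_annihilation_self']

/-- The doublon projector of `x` commutes with creators at other sites. [folklore] -/
theorem doublonAt_mul_creation_of_ne {x a : Λ} (h : a ≠ x) (σ : Fin 2) :
    (numberOp x 0 * numberOp x 1 * creation (orb a σ)) =
      creation (orb a σ) * (numberOp x 0 * numberOp x 1) := by
  have h0 : (orb x 0 : Orb Λ) ≠ orb a σ := by simp [Ne.symm h]
  have h1 : (orb x 1 : Orb Λ) ≠ orb a σ := by simp [Ne.symm h]
  rw [mul_assoc, numberOp_mul_creation_of_ne' h1, ← mul_assoc, numberOp_mul_creation_of_ne' h0,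
    mul_assoc]

/-- The doublon projector of `x` commutes with annihilators at other sites. [folklore] -/
theorem doublonAt_mul_annihilation_of_ne {x a : Λ} (h : a ≠ x) (σ : Fin 2) :
    (numberOp x 0 * numberOp x 1 * annihilation (orb a σ)) =
      annihilation (orb a σ) * (numberOp x 0 * numberOp x 1) := by
  have h0 : (orb x 0 : Orb Λ) ≠ orb a σ := by simp [Ne.symm h]
  have h1 : (orb x 1 : Orb Λ) ≠ orb a σ := by simp [Ne.symm h]
  rw [mul_assoc, numberOp_mul_annihilation_of_ne' h1, ← mul_assoc,
    numberOp_mul_annihilation_of_ne' h0, mul_assoc]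

/-- **The one-doublon part of a hop into `x`.** Summed over spin, the doublon projector times the
hops `c†_{xσ} c_{yσ}` is minus the on-site pair creator times the singlet pair annihilator:
`n_{x↑}n_{x↓} Σ_σ c†_{xσ} c_{yσ} = -c†_{x↑} c†_{x↓} (c_{x↑} c_{y↓} - c_{x↓} c_{y↑})`.
Yang, PRL 63 (1989) 2144 (η-pair algebra); Tasaki (2020) §9.3. [folklore] -/
theorem doublonAt_mul_sum_hop_from (x y : Λ) :
    (numberOp x 0 * numberOp x 1 * ∑ σ : Fin 2, creation (orb x σ) * annihilation (orb y σ)) =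
      -(creation (orb x 0) * creation (orb x 1) *
        (annihilation (orb x 0) * annihilation (orb y 1) -
          annihilation (orb x 1) * annihilation (orb y 0))) := by
  have h01 := orb_zero_ne_orb_one' x
  rw [Fin.sum_univ_two, mul_add]
  have e1 : (numberOp x 0 * numberOp x 1 * (creation (orb x 0) * annihilation (orb y 0))) =
      numberOp x 1 * (creation (orb x 0) * annihilation (orb y 0)) := by
    rw [numberOp_comm' x x 0 1, mul_assoc, ← mul_assoc (numberOp x 0), numberOp_mul_creation_self']
  have e2 : (numberOp x 0 * numberOp x 1 * (creation (orb x 1) * annihilation (orb y 1))) =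
      numberOp x 0 * (creation (orb x 1) * annihilation (orb y 1)) := by
    rw [mul_assoc, ← mul_assoc (numberOp x 1), numberOp_mul_creation_self']
  have hca : (creation (orb x 1) * annihilation (orb x 0)) =
      -(annihilation (orb x 0) * creation (orb x 1)) := by
    rw [annihilation_mul_creation, if_neg h01, zero_sub, neg_neg]
  have k1 : (creation (orb x 0) * creation (orb x 1) * (annihilation (orb x 0) * annihilation (orb y 1))) = -(numberOp x 0 * (creation (orb x 1) * annihilation (orb y 1))) := by
    rw [show (creation (orb x 0) * creation (orb x 1) * (annihilation (orb x 0) * annihilation (orb y 1))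
       ) = creation (orb x 0) * (creation (orb x 1) * annihilation (orb x 0)) * annihilation (orb y 1)
        by simp only [mul_assoc], hca]
    simp only [mul_neg, neg_mul, mul_assoc, numberOp]
  have k2 : (creation (orb x 0) * creation (orb x 1) * (annihilation (orb x 1) * annihilation (orb y 0))) = numberOp x 1 * (creation (orb x 0) * annihilation (orb y 0)) := by
    rw [show (creation (orb x 0) * creation (orb x 1) * (annihilation (orb x 1) * annihilation (orb y 0))
       ) = creation (orb x 0) * numberOp x 1 * annihilation (orb y 0) by simp only [numberOp, mul_assoc],
      ← numberOp_mul_creation_of_ne' h01.symm, mul_assoc]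
  rw [e1, e2, mul_sub, k1, k2]
  abel

/-- **The on-site pair creator is undone by the pair annihilator up to vacancy projectors**:
`c_{x↓} c_{x↑} c†_{x↑} c†_{x↓} = (1 - n_{x↑})(1 - n_{x↓})`. Yang, PRL 63 (1989) 2144. [folklore] -/
theorem pairAnnihilate_mul_pairCreate (x : Λ) :
    (annihilation (orb x 1) * annihilation (orb x 0) * (creation (orb x 0) * creation (orb x 1))) =
      (1 - numberOp x 0) * (1 - numberOp x 1) := by
  have hac : ∀ σ : Fin 2, (annihilation (orb x σ) * creation (orb x σ)) = 1 - numberOp x σ :=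
    fun σ => by rw [annihilation_mul_creation, if_pos rfl]; rfl
  calc (annihilation (orb x 1) * annihilation (orb x 0) * (creation (orb x 0) * creation (orb x 1)))
      = annihilation (orb x 1) * (annihilation (orb x 0) * creation (orb x 0)) * creation (orb x 1) := by
        simp only [mul_assoc]
    _ = annihilation (orb x 1) * creation (orb x 1) -
          annihilation (orb x 1) * numberOp x 0 * creation (orb x 1) := by
        rw [hac 0, mul_sub, mul_one, sub_mul]
    _ = (1 - numberOp x 1) - numberOp x 0 * (1 - numberOp x 1) := by
        rw [hac 1, ← numberOp_mul_annihilation_of_ne' (orb_zero_ne_orb_one' x), mul_assoc, hac 1]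
    _ = (1 - numberOp x 0) * (1 - numberOp x 1) := by rw [sub_mul, one_mul]

/-- `D φ = 0` for the doublon number `D = Σ_x n_{x↑} n_{x↓}` forces `n_{x↑} n_{x↓} φ = 0` at every
site (the summands are `0/1`-diagonal matrices). Yang, PRL 63 (1989) 2144. [folklore] -/
theorem doublonAt_mulVec_eq_zero_of_doublon_mulVec_eq_zero {φ : Fock (Orb Λ)}
    (h : (∑ x : Λ, numberOp x 0 * numberOp x 1) *ᵥ φ = 0) (x : Λ) :
    (numberOp x 0 * numberOp x 1) *ᵥ φ = 0 := by
  classical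
  have hdiag : ∀ z : Λ, (numberOp z 0 * numberOp z 1) =
      diagonal fun s => if orb z 0 ∈ s ∧ orb z 1 ∈ s then 1 else 0 := by
    intro z
    rw [LiebThm1.numberOp_eq_diagonal, LiebThm1.numberOp_eq_diagonal, diagonal_mul_diagonal]
    congr 1; funext s
    by_cases h0 : orb z 0 ∈ s <;> by_cases h1 : orb z 1 ∈ s <;> simp [h0, h1]
  funext s
  have hs := congrFun h s
  rw [Matrix.sum_mulVec, Finset.sum_apply] at hs
  simp only [hdiag, mulVec_diagonal] at hs ⊢
  rw [Pi.zero_apply]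
  by_cases hx : orb x 0 ∈ s ∧ orb x 1 ∈ s
  · rw [if_pos hx, one_mul]
    rw [← Finset.sum_mul, Finset.sum_boole, Pi.zero_apply] at hs
    have hcard : (((Finset.univ.filter fun z : Λ => orb z 0 ∈ s ∧ orb z 1 ∈ s).card : ℕ) : ℂ) ≠ 0 := by
      rw [Nat.cast_ne_zero, ← Nat.pos_iff_ne_zero, Finset.card_pos]
      exact ⟨x, Finset.mem_filter.2 ⟨Finset.mem_univ _, hx⟩⟩
    exact (mul_eq_zero.1 hs).resolve_left hcard
  · rw [if_neg hx, zero_mul]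

end OneSite

/-! ### The doublon-free identity on a general graph -/

section Graph

variable {Λ : Type*} [LinearOrder Λ] [Fintype Λ] (G : SimpleGraph Λ) [DecidableRel G.Adj]


/-- **Doublon-free vectors with doublon-free hopping image are killed by every local extended-`s`
singlet operator**: if `D ψ = 0` and `D (H(t,0) ψ) = 0` with `t ≠ 0` (e.g. `ψ` a doublon-free
eigenvector of any `H(t,U)`), then `Σ_{y ∼ x} (c_{x↑} c_{y↓} - c_{x↓} c_{y↑}) ψ = 0` for every `x`:
`n_{x↑}n_{x↓} H(t,0) ψ = t c†_{x↑}c†_{x↓} B_x ψ` (hops not starting at `x` meet `n_{x↑}n_{x↓} c_{xσ} = 0`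
or commute with the projector, and `n_{x↑}n_{x↓} ψ = 0`; hops into `x`: `doublonAt_mul_sum_hop_from`),
then `pairAnnihilate_mul_pairCreate` with `n_{xσ} B_x ψ = 0`. Bruus–Anglès d'Auriac (1997) §5.2. [folklore] -/
theorem singletStar_mulVec_eq_zero_of_doublonFree {t : ℝ} (ht : t ≠ 0) {ψ : Fock (Orb Λ)}
    (hD : (∑ x : Λ, numberOp x 0 * numberOp x 1) *ᵥ ψ = 0)
    (hDT : (∑ x : Λ, numberOp x 0 * numberOp x 1) *ᵥ (hamiltonian G t 0 *ᵥ ψ) = 0) (x : Λ) :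
    (∑ y : Λ, if G.Adj x y then (annihilation (orb x 0) * annihilation (orb y 1) -
        annihilation (orb x 1) * annihilation (orb y 0)) else 0) *ᵥ ψ = 0 := by
  classical
  have hPψ : ∀ z : Λ, (numberOp z 0 * numberOp z 1) *ᵥ ψ = 0 :=
    doublonAt_mulVec_eq_zero_of_doublon_mulVec_eq_zero hD
  have hPT : (numberOp x 0 * numberOp x 1) *ᵥ (hamiltonian G t 0 *ᵥ ψ) = 0 :=
    doublonAt_mulVec_eq_zero_of_doublon_mulVec_eq_zero hDT x
  -- Step 1: the doublon projector on the hopping image of `ψ`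
  have hhop : (numberOp x 0 * numberOp x 1) *ᵥ ((∑ a : Λ, ∑ b : Λ, ∑ σ : Fin 2,
      if G.Adj a b then (creation (orb a σ) * annihilation (orb b σ)) else 0) *ᵥ ψ) =
      -((creation (orb x 0) * creation (orb x 1)) *ᵥ ((∑ y : Λ, if G.Adj x y then
        (annihilation (orb x 0) * annihilation (orb y 1) -
          annihilation (orb x 1) * annihilation (orb y 0)) else 0) *ᵥ ψ)) := by
    rw [Matrix.mulVec_mulVec, Finset.mul_sum, Matrix.sum_mulVec, Finset.sum_eq_single x]
    · -- the hops into `x`, as an operator identity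
      have hop : (numberOp x 0 * numberOp x 1 * ∑ b : Λ, ∑ σ : Fin 2,
          if G.Adj x b then (creation (orb x σ) * annihilation (orb b σ)) else 0) =
          -(creation (orb x 0) * creation (orb x 1) * ∑ y : Λ, if G.Adj x y then
            (annihilation (orb x 0) * annihilation (orb y 1) -
              annihilation (orb x 1) * annihilation (orb y 0)) else 0) := by
        rw [Finset.mul_sum, Finset.mul_sum, ← Finset.sum_neg_distrib]
        refine Finset.sum_congr rfl fun b _ => ?_
        by_cases hab : G.Adj x b
        · simp only [if_pos hab]
          exact doublonAt_mul_sum_hop_from x b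
        · simp [if_neg hab]
      rw [hop, Matrix.neg_mulVec, Matrix.mulVec_mulVec]
    · -- the hops not starting at `x` vanish on `ψ`
      intro a _ hax
      rw [Finset.mul_sum, Matrix.sum_mulVec]
      refine Finset.sum_eq_zero fun b _ => ?_
      rw [Finset.mul_sum, Matrix.sum_mulVec]
      refine Finset.sum_eq_zero fun σ _ => ?_
      rw [mul_ite, mul_zero]
      split_ifs with hab
      · by_cases hbx : b = x
        · rw [hbx, ← mul_assoc, doublonAt_mul_creation_of_ne hax, mul_assoc,
            doublonAt_mul_annihilation_self, mul_zero, Matrix.zero_mulVec]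
        · rw [← mul_assoc, doublonAt_mul_creation_of_ne hax, mul_assoc,
            doublonAt_mul_annihilation_of_ne hbx, ← mul_assoc, ← Matrix.mulVec_mulVec, hPψ x,
            Matrix.mulVec_zero]
      · exact Matrix.zero_mulVec _
    · exact fun h => absurd (Finset.mem_univ x) h
  -- Step 2: `H(t,0) ψ = -t · (hopping) ψ`, so `c†_{x↑}c†_{x↓} B_x ψ = 0`
  have hH : hamiltonian G t 0 *ᵥ ψ = -(t : ℂ) • ((∑ a : Λ, ∑ b : Λ, ∑ σ : Fin 2,
      if G.Adj a b then (creation (orb a σ) * annihilation (orb b σ)) else 0) *ᵥ ψ) := by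
    rw [hamiltonian, Complex.ofReal_zero, zero_smul, add_zero, Matrix.smul_mulVec]
  rw [hH, Matrix.mulVec_smul, hhop, smul_neg, neg_eq_zero, smul_eq_zero] at hPT
  have hCB := hPT.resolve_left (neg_ne_zero.2 (Complex.ofReal_ne_zero.2 ht))
  -- Step 3: `n_{xσ} B_x ψ = 0`
  set χ : Fock (Orb Λ) := (∑ y : Λ, if G.Adj x y then
      (annihilation (orb x 0) * annihilation (orb y 1) -
        annihilation (orb x 1) * annihilation (orb y 0)) else 0) *ᵥ ψ with hχ
  have h01 := orb_zero_ne_orb_one' x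
  have hn0 : numberOp x 0 *ᵥ χ = 0 := by
    rw [hχ, Matrix.mulVec_mulVec, Finset.mul_sum, Matrix.sum_mulVec]
    refine Finset.sum_eq_zero fun b _ => ?_
    rw [mul_ite, mul_zero]
    split_ifs with hab
    · have hbx : b ≠ x := (G.ne_of_adj hab).symm
      have hb0 : (orb x 0 : Orb Λ) ≠ orb b 0 := by simp [hbx.symm]
      have hb1 : (orb x 1 : Orb Λ) ≠ orb b 0 := by simp [hbx.symm]
      have hR : (annihilation (orb x 1) * annihilation (orb b 0) * (numberOp x 0 * numberOp x 1)) =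
          annihilation (orb x 1) * annihilation (orb b 0) * numberOp x 0 := by
        rw [numberOp_comm' x x 0 1, ← mul_assoc, mul_assoc (annihilation (orb x 1)),
          ← numberOp_mul_annihilation_of_ne' hb1, ← mul_assoc, annihilation_mul_numberOp_self']
      have hopid : (numberOp x 0 * (annihilation (orb x 0) * annihilation (orb b 1) -
          annihilation (orb x 1) * annihilation (orb b 0))) =
          -(annihilation (orb x 1) * annihilation (orb b 0)) * (numberOp x 0 * numberOp x 1) := by
        rw [mul_sub, ← mul_assoc, numberOp_mul_annihilation_self', zero_mul, zero_sub, ← mul_assoc,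
          numberOp_mul_annihilation_of_ne' h01, mul_assoc, numberOp_mul_annihilation_of_ne' hb0,
          ← mul_assoc, ← hR, neg_mul]
      rw [hopid, ← Matrix.mulVec_mulVec, hPψ x, Matrix.mulVec_zero]
    · exact Matrix.zero_mulVec _
  have hn1 : numberOp x 1 *ᵥ χ = 0 := by
    rw [hχ, Matrix.mulVec_mulVec, Finset.mul_sum, Matrix.sum_mulVec]
    refine Finset.sum_eq_zero fun b _ => ?_
    rw [mul_ite, mul_zero]
    split_ifs with hab
    · have hbx : b ≠ x := (G.ne_of_adj hab).symm
      have hb1 : (orb x 1 : Orb Λ) ≠ orb b 1 := by simp [hbx.symm]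
      have hb0 : (orb x 0 : Orb Λ) ≠ orb b 1 := by simp [hbx.symm]
      have hR : (annihilation (orb x 0) * annihilation (orb b 1) * (numberOp x 0 * numberOp x 1)) =
          annihilation (orb x 0) * annihilation (orb b 1) * numberOp x 1 := by
        rw [← mul_assoc, mul_assoc (annihilation (orb x 0)), ← numberOp_mul_annihilation_of_ne' hb0,
          ← mul_assoc, annihilation_mul_numberOp_self']
      have hopid : (numberOp x 1 * (annihilation (orb x 0) * annihilation (orb b 1) -
          annihilation (orb x 1) * annihilation (orb b 0))) =
          (annihilation (orb x 0) * annihilation (orb b 1)) * (numberOp x 0 * numberOp x 1) := by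
        rw [mul_sub, ← mul_assoc (numberOp x 1) (annihilation (orb x 1)),
          numberOp_mul_annihilation_self', zero_mul, sub_zero, ← mul_assoc,
          numberOp_mul_annihilation_of_ne' h01.symm, mul_assoc, numberOp_mul_annihilation_of_ne' hb1,
          ← mul_assoc, ← hR]
      rw [hopid, ← Matrix.mulVec_mulVec, hPψ x, Matrix.mulVec_zero]
    · exact Matrix.zero_mulVec _
  -- Step 4: injectivity of the pair creator on `χ`
  have hfix : (annihilation (orb x 1) * annihilation (orb x 0) *
      (creation (orb x 0) * creation (orb x 1))) *ᵥ χ = χ := by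
    rw [pairAnnihilate_mul_pairCreate, ← Matrix.mulVec_mulVec, Matrix.sub_mulVec, Matrix.one_mulVec,
      Matrix.sub_mulVec, Matrix.one_mulVec, hn1, sub_zero, hn0, sub_zero]
  rw [← hfix, ← Matrix.mulVec_mulVec, hCB, Matrix.mulVec_zero]

end Graph

/-! ### Torus form: doublon-free eigenvectors are extended-`s`-wave dark -/

section Torus

variable (L : ℕ) [NeZero L]


/-- `localPair extendedSWave L x = (1/√2) Σ_{y ∼ x} (c_{x↑} c_{y↓} - c_{x↓} c_{y↑})` on the torus graph
(`L ≥ 3`: the four neighbours `x ± eᵢ` are distinct). Scalapino (1995) §2 eq. (2.2). [folklore] -/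
theorem localPair_extendedSWave_eq_smul_sum_adj (hL : 3 ≤ L) (x : TorusSite 2 L) :
    localPair extendedSWave L x = ((1 / Real.sqrt 2 : ℝ) : ℂ) •
      ∑ y : FermionTorus 2 L, if (fermionTorusGraph 2 L).Adj (FermionTorus.ofTorusSite x) y then
        (annihilation (orb (FermionTorus.ofTorusSite x) 0) * annihilation (orb y 1) -
          annihilation (orb (FermionTorus.ofTorusSite x) 1) * annihilation (orb y 0)) else 0 := by
  -- the neighbour sum in directed-bond form
  have hsum : (∑ y : FermionTorus 2 L,
      if (fermionTorusGraph 2 L).Adj (FermionTorus.ofTorusSite x) y then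
        (annihilation (orb (FermionTorus.ofTorusSite x) 0) * annihilation (orb y 1) -
          annihilation (orb (FermionTorus.ofTorusSite x) 1) * annihilation (orb y 0)) else 0) =
      ∑ i : Fin 2,
        ((annihilation (orb (FermionTorus.ofTorusSite x) 0) *
            annihilation (orb (FermionTorus.ofTorusSite (x + Pi.single i 1)) 1) -
          annihilation (orb (FermionTorus.ofTorusSite x) 1) *
            annihilation (orb (FermionTorus.ofTorusSite (x + Pi.single i 1)) 0)) +
        (annihilation (orb (FermionTorus.ofTorusSite x) 0) *
            annihilation (orb (FermionTorus.ofTorusSite (x - Pi.single i 1)) 1) -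
          annihilation (orb (FermionTorus.ofTorusSite x) 1) *
            annihilation (orb (FermionTorus.ofTorusSite (x - Pi.single i 1)) 0))) := by
    rw [FermionTorus.sum_eq_sum_torusSite]
    simp only [fermionTorusGraph_adj, FermionTorus.toTorusSite_ofTorusSite]
    exact sum_ite_torusGraph_adj_matrix hL x _
  rw [hsum, localPair, Finset.sum_insert zero_not_mem_unitSteps,
    show extendedSWave 0 = 0 from if_neg zero_not_mem_unitSteps, zero_div, Complex.ofReal_zero,
    zero_smul, zero_add, Finset.sum_congr rfl fun e he => by rw [show extendedSWave e = 1 from if_pos he],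
    ← Finset.smul_sum,
    sum_unitSteps, Fin.sum_univ_two, torusProj_unitStep, torusProj_unitStep, torusProj_neg_unitStep,
    torusProj_neg_unitStep, ← sub_eq_add_neg, ← sub_eq_add_neg]
  congr 1
  abel

/-- **Doublon-free eigenvectors of the Hubbard torus are extended-`s`-wave dark, locally**
(`L ≥ 3`, `t ≠ 0`, any `U`, any eigenvalue): if `H(t,U) ψ = E ψ` and `D ψ = 0` then
`localPair extendedSWave L x ψ = 0` for every `x` (`H(t,0) ψ = E ψ` too, so `D (H(t,0) ψ) = 0`
and `singletStar_mulVec_eq_zero_of_doublonFree` applies). The `d`-wave analogue fails, see the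
module docstring. Bruus–Anglès d'Auriac, PRB 55 (1997) 9142, §5.2. [folklore] -/
theorem localPair_extendedSWave_mulVec_eq_zero_of_eigen_doublonFree (hL : 3 ≤ L) {t : ℝ}
    (ht : t ≠ 0) (U : ℝ) {E : ℂ} {ψ : Fock (Orb (FermionTorus 2 L))}
    (hH : hubbardTorus 2 L t U *ᵥ ψ = E • ψ)
    (hD : (∑ x : FermionTorus 2 L, numberOp x 0 * numberOp x 1) *ᵥ ψ = 0) (x : TorusSite 2 L) :
    localPair extendedSWave L x *ᵥ ψ = 0 := by
  have h0 : hamiltonian (fermionTorusGraph 2 L) t 0 *ᵥ ψ = E • ψ := by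
    have h := hH
    rw [hubbardTorus, hamiltonian_eq_add_smul_doublon, Matrix.add_mulVec, Matrix.smul_mulVec,
      hD, smul_zero, add_zero] at h
    exact h
  have hDT : (∑ x : FermionTorus 2 L, numberOp x 0 * numberOp x 1) *ᵥ
      (hamiltonian (fermionTorusGraph 2 L) t 0 *ᵥ ψ) = 0 := by
    rw [h0, Matrix.mulVec_smul, hD, smul_zero]
  rw [localPair_extendedSWave_eq_smul_sum_adj L hL x, Matrix.smul_mulVec,
    singletStar_mulVec_eq_zero_of_doublonFree (fermionTorusGraph 2 L) ht hD hDT, smul_zero]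

end Torus

/-- **Doublon-free eigenvectors of the Hubbard torus are extended-`s`-wave dark** (`L ≥ 3`,
`t ≠ 0`, any `U`, any eigenvalue; in particular every doublon-free sector ground state `ψ`,
whose eigen-equation is `hgs.2.2` for `hgs : IsGroundStateInSector (hubbardTorus 2 L 1 U) N M ψ`):
every `localPair extendedSWave L x` and the pair field `pairField extendedSWave L` kill `ψ` (so
`⟨ψ, Δ_{s*}† Δ_{s*} ψ⟩ = 0`). A T/U state with doublon eigenvalue `0` is `Δ_{s*}`-dark; it need
NOT be `Δ_d`-dark. Registered sub-goal of `stub_noJointEigenGround` (its doublon-free case, in the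
form that is true). Bruus–Anglès d'Auriac, PRB 55 (1997) 9142, §5.2; Scalapino (1995) §2. [folklore] -/
theorem extendedSWave_dark_of_eigen_doublonFree : ∀ (L : ℕ) [NeZero L], 3 ≤ L → ∀ (t : ℝ), t ≠ 0 →
    ∀ (U : ℝ) (E : ℂ) (ψ : Fock (Orb (FermionTorus 2 L))), hubbardTorus 2 L t U *ᵥ ψ = E • ψ →
    (∑ x : FermionTorus 2 L, numberOp x 0 * numberOp x 1) *ᵥ ψ = 0 →
    (∀ x : TorusSite 2 L, localPair extendedSWave L x *ᵥ ψ = 0) ∧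
      pairField extendedSWave L *ᵥ ψ = 0 := by
  intro L _ hL t ht U E ψ hH hD
  refine ⟨fun x => localPair_extendedSWave_mulVec_eq_zero_of_eigen_doublonFree L hL ht U hH hD x, ?_⟩
  rw [pairField, Matrix.sum_mulVec]
  exact Finset.sum_eq_zero fun x _ =>
    localPair_extendedSWave_mulVec_eq_zero_of_eigen_doublonFree L hL ht U hH hD x


end Summit.HubbardSuperconductivity.HubbardSuperconductivity.Theorems
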